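import Literature.Geometry.Lorentzian.LeviCivita
import HarnessLib

/-!
# Calculus in a single chart: the Levi-Civita connection, Hessian and wave operator of a
# pseudo-Riemannian metric on an open subset of a normed space, in coordinates

(trunk G08 = T-LORENTZ; namespaces `Literature.Lorentz.OpensChart`, `Literature.Geometry.Lorentzian.PseudoRiemannianMetric`)

The prelude (`LeviCivita.lean`) defines the Levi-Civita connection `g.leviCivita` of a `C^n`
pseudo-Riemannian metric through the Koszul formula on `FiberBundle.extend`ed tangent vectors,
the Hessian `g.hessian f x` as "the bilinear form agreeing with `X(Yf) − (∇_X Y)f` on extended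
vectors, if one exists" and the wave operator `g.dalembertian f x = tr_g (Hess f)_x`. All the
concrete metrics of the library (Minkowski, Schwarzschild, Kerr in Kerr–Schild form, …) live on
open subsets `U : Opens E` of a finite-dimensional real normed space `E`, regarded as manifolds
modelled on `𝓘(ℝ, E)` through Mathlib's `TopologicalSpace.Opens.instChartedSpace`. This file
computes the abstract objects in that situation, i.e. it proves the classical coordinate formulas
(O'Neill 1983, Ch. 3, Prop. 13, Lemma 49 and the display following Def. 50):

* `OpensChart.extChartAt_apply`, `mfderiv_eq`, `mvfderiv_eq`, `contMDiffAt_iff`,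
  `mdifferentiableAt_iff`: the preferred chart of `U` at any point is the inclusion `U → E`, so
  manifold derivatives of `f : U → F` are Fréchet derivatives of any representative `Φ : E → F`
  with `f y = Φ y`;
* `OpensChart.trivializationAt_apply`, `extend_eq_const`, `mlieBracket_eq`, `mlieBracket_const`:
  the tangent bundle of `U` is trivialised by the identity, `FiberBundle.extend v` is the
  *constant* vector field `v`, and the manifold Lie bracket is the Lie bracket of representatives
  (so constant fields commute);
* `OpensChart.bilin_trivializationAt_apply`, `contMDiffAt_bilinSection_iff`: the bundle of
  bilinear forms over `U` (in which metrics are sections) is trivialised by the identity, so a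
  metric on `U` is `C^n` iff its components `G : E → (E →L E →L ℝ)` are;
* `PseudoRiemannianMetric.leviCivitaFun_eq_of_forall`, `hessian_eq_of_forall`,
  `sharp_eq_of_forall`: the uniqueness clauses implicit in the prelude's definitions (any
  manifold, resp. any bundle metric);
* `OpensChart.koszulFunctional_const`, `christoffel`, `leviCivita_const`: for a metric whose
  components `g.val y = G y` are differentiable, `∇_{X₀} Y₀ = Γ_x(X₀, Y₀)` on constant fields, where
  `2 g(Γ(X₀, Y₀), Z₀) = ∂_{X₀}G(Y₀, Z₀) + ∂_{Y₀}G(Z₀, X₀) − ∂_{Z₀}G(X₀, Y₀)` (O'Neill, Prop. 3.13);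
* `OpensChart.hessian_eq`, `dalembertian_eq`, `dalembertian_eq_sum`: for `f y = Φ y` with `Φ` of
  class `C²` at `x`, `Hess f (X₀, Y₀) = D²Φ(x)(X₀, Y₀) − DΦ(x)(Γ(X₀, Y₀))` (O'Neill, Lemma 3.49) and
  `□_g f (x) = ∑_{ij} g^{ij} (∂_i∂_j Φ − Γ^k_{ij} ∂_k Φ)` in any basis (O'Neill, Ch. 3, the
  display following Def. 3.50).

This is the bridge between the abstract wave equation `□_g ψ = 0` of the black-hole statements
(`BlackHoles.lean`, gr.S24) and coordinate computations (energy identities, Kerr–Schild algebra).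

## Design

* Everything is stated for `E` a real normed space (finite-dimensional and complete where the
  prelude requires it) and `U : Opens E`; representatives `Φ : E → F` enter through the pointwise
  hypothesis `∀ y : U, f y = Φ y` (for `f : U → F` one may take `Φ = Function.extend Subtype.val f 0`,
  as in `WeightedNorms.coordEnergyDensity`).
* Identities between continuous linear maps on tangent spaces are stated *pointwise* or at the
  model type `E` (the tangent spaces `TangentSpace 𝓘(ℝ, E) x` are definitionally `E`, but instance
  paths differ, which defeats `rw`); e.g. `christoffel g G x Y₀ : E →L[ℝ] E`.
* No new instances, no `sorry`; Mathlib has none of this beyond the model-space case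
  (`mlieBracketWithin_eq_lieBracketWithin`, `TangentBundle.coordChange_model_space`).

## References

* B. O'Neill, *Semi-Riemannian geometry with applications to relativity*, Academic Press 1983,
  Ch. 3: Thm. 11 (Koszul formula), Def. 12 and Prop. 13 (Christoffel symbols, coordinate formula
  for `D`), Lemma 49 (Hessian), Def. 50 and the display following it (coordinate Laplacian)
  (key `ONeill1983`).
-/

noncomputable section

open Set Manifold TopologicalSpace Filter VectorField
open scoped ContDiff Topology Manifold

namespace Literature.Geometry.Lorentzian

/-! ## Charts, derivatives and the tangent bundle of `U : Opens E` -/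

namespace OpensChart

variable {E : Type*} [NormedAddCommGroup E] [NormedSpace ℝ E] {U : Opens E}
variable {F : Type*} [NormedAddCommGroup F] [NormedSpace ℝ F]

omit [NormedSpace ℝ E] in
/-- The preferred chart of `U` at `x` is the inclusion: `chartAt E x y = y`
(`Opens.chartAt_eq`: it is `(chartAt E x.1).subtypeRestr ⟨x⟩` with `chartAt E x.1 = refl`).
[folklore] -/
theorem chartAt_apply (x y : U) : chartAt E x y = (y : E) := rfl

omit [NormedSpace ℝ E] in
/-- The preferred chart of `U` is defined on all of `U`. [folklore] -/
theorem chartAt_source (x : U) : (chartAt E x).source = univ := by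
  simp [TopologicalSpace.Opens.chartAt_eq]

omit [NormedSpace ℝ E] in
/-- The preferred chart of `U` has target `U ⊆ E`. [folklore] -/
theorem chartAt_target (x : U) : (chartAt E x).target = (U : Set E) := by
  rw [TopologicalSpace.Opens.chartAt_eq, OpenPartialHomeomorph.subtypeRestr_def]
  simp

omit [NormedSpace ℝ E] in
/-- The inverse chart is a right inverse of the inclusion on `U`. [folklore] -/
theorem chartAt_symm_val (x : U) {y : E} (hy : y ∈ U) : ((chartAt E x).symm y : E) = y := by
  have hy' : y ∈ (chartAt E x).target := by rwa [chartAt_target]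
  exact (chartAt E x).right_inv hy'

/-- The extended chart of `U` at `x` is the chart itself (the model with corners is `𝓘(ℝ, E)`).
[folklore] -/
theorem extChartAt_eq (x : U) : extChartAt 𝓘(ℝ, E) x = (chartAt E x).toPartialEquiv := by
  simp [extChartAt, OpenPartialHomeomorph.extend]

/-- The extended chart of `U` at `x` is the inclusion: `extChartAt 𝓘(ℝ, E) x y = y`. [folklore] -/
theorem extChartAt_apply (x y : U) : extChartAt 𝓘(ℝ, E) x y = (y : E) := by
  rw [extChartAt_eq]; rfl

/-- The extended chart of `U` at `x`, as a function, is `Subtype.val`. [folklore] -/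
theorem extChartAt_coe (x : U) : ⇑(extChartAt 𝓘(ℝ, E) x) = Subtype.val := by
  funext y; exact extChartAt_apply x y

/-- The extended chart of `U` is defined on all of `U`. [folklore] -/
theorem extChartAt_source (x : U) : (extChartAt 𝓘(ℝ, E) x).source = univ := by
  rw [extChartAt_eq]; exact chartAt_source x

/-- The extended chart of `U` has target `U ⊆ E`. [folklore] -/
theorem extChartAt_target (x : U) : (extChartAt 𝓘(ℝ, E) x).target = (U : Set E) := by
  rw [extChartAt_eq]
  exact chartAt_target x

/-- The inverse extended chart is a right inverse of the inclusion on `U`. [folklore] -/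
theorem extChartAt_symm_val (x : U) {y : E} (hy : y ∈ U) :
    ((extChartAt 𝓘(ℝ, E) x).symm y : E) = y := by
  rw [extChartAt_eq]
  exact chartAt_symm_val x hy

omit [NormedSpace ℝ E] in
/-- `U` is a neighbourhood of each of its points in `E`. [folklore] -/
theorem coe_mem_nhds (x : U) : (U : Set E) ∈ 𝓝 (x : E) := U.2.mem_nhds x.2

/-- A map `f : U → F` read in the charts of `U` and `F` is `f ∘ (extChartAt x).symm`. [folklore] -/
theorem writtenInExtChartAt_eq (x : U) (f : U → F) :
    writtenInExtChartAt 𝓘(ℝ, E) 𝓘(ℝ, F) x f = f ∘ (extChartAt 𝓘(ℝ, E) x).symm := by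
  ext y; simp [writtenInExtChartAt]

omit [NormedAddCommGroup F] [NormedSpace ℝ F] in
/-- If `f y = Φ y` on `U`, then `f` read in the chart agrees with the representative `Φ` near
`x`. [folklore] -/
theorem comp_symm_eventuallyEq (x : U) (f : U → F) (Φ : E → F)
    (h : ∀ y : U, f y = Φ y) :
    f ∘ (extChartAt 𝓘(ℝ, E) x).symm =ᶠ[𝓝 (x : E)] Φ := by
  filter_upwards [coe_mem_nhds x] with y hy
  simp only [Function.comp_apply, h]
  rw [extChartAt_symm_val x hy]

/-- The transition maps of `U` are the identity near every point of `U`. [folklore] -/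
theorem extChartAt_comp_symm_eventuallyEq (x x' : U) {z : E} (hz : z ∈ U) :
    (extChartAt 𝓘(ℝ, E) x' ∘ (extChartAt 𝓘(ℝ, E) x).symm) =ᶠ[𝓝 z] id := by
  filter_upwards [U.2.mem_nhds hz] with y hy
  simp only [Function.comp_apply, id_eq]
  rw [extChartAt_apply, extChartAt_symm_val x hy]

/-! ### Manifold derivatives of maps out of `U` -/

omit [NormedSpace ℝ E] in
/-- Continuity of `f : U → Y` at `x` is continuity of a representative `Φ` at `x` (the inclusion
is an open embedding). [folklore] -/
theorem continuousAt_iff (x : U) {Y : Type*} [TopologicalSpace Y] (f : U → Y) (Φ : E → Y)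
    (h : ∀ y : U, f y = Φ y) : ContinuousAt f x ↔ ContinuousAt Φ x := by
  have hf : f = Φ ∘ Subtype.val := funext h
  rw [hf]
  exact U.isOpen.isOpenEmbedding_subtypeVal.continuousAt_iff (g := Φ) (x := x)

/-- Manifold differentiability of `f : U → F` at `x` is Fréchet differentiability of a
representative `Φ` at `x`. [folklore] -/
theorem mdifferentiableAt_iff (x : U) (f : U → F) (Φ : E → F) (h : ∀ y : U, f y = Φ y) :
    MDifferentiableAt 𝓘(ℝ, E) 𝓘(ℝ, F) f x ↔ DifferentiableAt ℝ Φ x := by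
  rw [_root_.mdifferentiableAt_iff, writtenInExtChartAt_eq, ModelWithCorners.range_eq_univ,
    differentiableWithinAt_univ, extChartAt_apply, continuousAt_iff x f Φ h,
    (comp_symm_eventuallyEq x f Φ h).differentiableAt_iff]
  exact ⟨fun h ↦ h.2, fun h ↦ ⟨h.continuousAt, h⟩⟩

/-- `C^n` regularity of `f : U → F` at `x` in the manifold sense is `C^n` regularity of a
representative `Φ` at `x` (Mathlib's `contMDiffAt_subtype_iff` and `contMDiffAt_iff_contDiffAt`).
[folklore] -/
theorem contMDiffAt_iff (x : U) {n : WithTop ℕ∞} (f : U → F) (Φ : E → F)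
    (h : ∀ y : U, f y = Φ y) :
    ContMDiffAt 𝓘(ℝ, E) 𝓘(ℝ, F) n f x ↔ ContDiffAt ℝ n Φ x := by
  have hf : f = fun y : U ↦ Φ y := funext h
  rw [hf, contMDiffAt_subtype_iff, contMDiffAt_iff_contDiffAt]

/-- **The manifold derivative in the chart `U` is the Fréchet derivative of a representative**:
`mfderiv f x = DΦ(x)` whenever `f y = Φ y` on `U` and `Φ` is differentiable at `x`. [folklore] -/
theorem mfderiv_eq (x : U) (f : U → F) (Φ : E → F) (h : ∀ y : U, f y = Φ y)
    (hΦ : DifferentiableAt ℝ Φ x) :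
    mfderiv 𝓘(ℝ, E) 𝓘(ℝ, F) f x = fderiv ℝ Φ x := by
  have hf : MDifferentiableAt 𝓘(ℝ, E) 𝓘(ℝ, F) f x := (mdifferentiableAt_iff x f Φ h).2 hΦ
  rw [mfderiv, if_pos hf, writtenInExtChartAt_eq, ModelWithCorners.range_eq_univ,
    fderivWithin_univ, extChartAt_apply]
  exact (comp_symm_eventuallyEq x f Φ h).fderiv_eq

/-- The vector-valued manifold derivative `mvfderiv` (used by the prelude's Koszul formula and
Hessian) in the chart `U` is the Fréchet derivative of a representative:
`mvfderiv f x v = DΦ(x) v`. [folklore] -/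
theorem mvfderiv_eq (x : U) (f : U → F) (Φ : E → F) (h : ∀ y : U, f y = Φ y)
    (hΦ : DifferentiableAt ℝ Φ x) (v : TangentSpace 𝓘(ℝ, E) x) :
    mvfderiv 𝓘(ℝ, E) f x v = fderiv ℝ Φ x v := by
  simp only [mvfderiv, ContinuousLinearMap.coe_comp, Function.comp_apply]
  rw [mfderiv_eq x f Φ h hΦ]
  rfl

/-- The derivative of the extended chart (the inclusion) is the identity. [folklore] -/
theorem mfderiv_extChartAt_apply (x : U) (v : TangentSpace 𝓘(ℝ, E) x) :
    mfderiv 𝓘(ℝ, E) 𝓘(ℝ, E) (extChartAt 𝓘(ℝ, E) x) x v = v := by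
  rw [mfderiv_eq x _ id (fun y ↦ extChartAt_apply x y) differentiableAt_id, fderiv_id]
  rfl

/-- The (Mathlib) inverse of the derivative of the extended chart is the identity. [folklore] -/
theorem inverse_mfderiv_extChartAt_apply (x : U) (v : E) :
    (mfderiv 𝓘(ℝ, E) 𝓘(ℝ, E) (extChartAt 𝓘(ℝ, E) x) x).inverse v = v := by
  have key : (mfderiv 𝓘(ℝ, E) 𝓘(ℝ, E) (extChartAt 𝓘(ℝ, E) x) x : E →L[ℝ] E) =
      ContinuousLinearMap.id ℝ E := by
    ext w; exact mfderiv_extChartAt_apply x w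
  change ContinuousLinearMap.inverse (mfderiv 𝓘(ℝ, E) 𝓘(ℝ, E) (extChartAt 𝓘(ℝ, E) x) x :
    E →L[ℝ] E) v = v
  rw [key]
  exact congrArg (fun A : E →L[ℝ] E ↦ A v) (ContinuousLinearMap.inverse_id (R := ℝ) (M := E))

/-- The derivative of the inverse extended chart at a point of `U` is the identity. [folklore] -/
theorem mfderiv_extChartAt_symm_apply (x : U) {y : E} (hy : y ∈ U) (v : E) :
    mfderiv 𝓘(ℝ, E) 𝓘(ℝ, E) (extChartAt 𝓘(ℝ, E) x).symm y v = v := by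
  have hy' : y ∈ (extChartAt 𝓘(ℝ, E) x).target := by rwa [extChartAt_target]
  have hd : MDifferentiableAt 𝓘(ℝ, E) 𝓘(ℝ, E) (extChartAt 𝓘(ℝ, E) x).symm y := by
    have := mdifferentiableWithinAt_extChartAt_symm hy'
    rwa [ModelWithCorners.range_eq_univ, mdifferentiableWithinAt_univ] at this
  rw [mfderiv, if_pos hd]
  simp only [writtenInExtChartAt, extChartAt_coe, extChartAt_model_space_eq_id,
    PartialEquiv.refl_symm, PartialEquiv.refl_coe, Function.comp_id, modelWithCornersSelf_coe, id_eq,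
    Set.range_id, fderivWithin_univ]
  have : (Subtype.val ∘ (extChartAt 𝓘(ℝ, E) x).symm) =ᶠ[𝓝 y] id := by
    have := extChartAt_comp_symm_eventuallyEq x x hy
    rwa [extChartAt_coe] at this
  rw [this.fderiv_eq, fderiv_id]
  rfl

/-- The (Mathlib) inverse of the derivative of the inverse extended chart is the identity.
[folklore] -/
theorem inverse_mfderiv_extChartAt_symm_apply (x : U) {y : E} (hy : y ∈ U) (v : E) :
    (mfderiv 𝓘(ℝ, E) 𝓘(ℝ, E) (extChartAt 𝓘(ℝ, E) x).symm y).inverse v = v := by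
  have key : (mfderiv 𝓘(ℝ, E) 𝓘(ℝ, E) (extChartAt 𝓘(ℝ, E) x).symm y : E →L[ℝ] E) =
      ContinuousLinearMap.id ℝ E := by
    ext w; exact mfderiv_extChartAt_symm_apply x hy w
  change ContinuousLinearMap.inverse (mfderiv 𝓘(ℝ, E) 𝓘(ℝ, E) (extChartAt 𝓘(ℝ, E) x).symm y :
    E →L[ℝ] E) v = v
  rw [key]
  exact congrArg (fun A : E →L[ℝ] E ↦ A v) (ContinuousLinearMap.inverse_id (R := ℝ) (M := E))

/-! ### The tangent bundle of `U` is trivialised by the identity -/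

/-- The coordinate changes of the tangent bundle core of `U` are the identity. [folklore] -/
theorem tangentCoordChange_eq_one (x x' z : U) :
    (tangentBundleCore 𝓘(ℝ, E) U).coordChange (achart E x) (achart E x') z = 1 := by
  rw [tangentBundleCore_coordChange_achart, ModelWithCorners.range_eq_univ, fderivWithin_univ,
    extChartAt_apply, (extChartAt_comp_symm_eventuallyEq x x' z.2).fderiv_eq, fderiv_id]
  rfl

/-- The preferred trivialisation of `TU` at `x` is `⟨z, v⟩ ↦ (z, v)`. [folklore] -/
theorem trivializationAt_apply (x z : U) (v : E) :
    trivializationAt E (TangentSpace 𝓘(ℝ, E)) x (⟨z, v⟩ : TangentBundle 𝓘(ℝ, E) U) =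
      ((z : U), v) := by
  rw [TangentBundle.trivializationAt_apply]
  simp only [Prod.mk.injEq, true_and]
  rw [← extChartAt, ← extChartAt, ModelWithCorners.range_eq_univ, fderivWithin_univ,
    extChartAt_apply, (extChartAt_comp_symm_eventuallyEq z x z.2).fderiv_eq, fderiv_id]
  rfl

/-- The inverse of the preferred trivialisation of `TU` is the identity on fibres. [folklore] -/
theorem trivializationAt_symm_apply (x z : U) (v : E) :
    (trivializationAt E (TangentSpace 𝓘(ℝ, E)) x).symm z v = v := by
  have hz : z ∈ (trivializationAt E (TangentSpace 𝓘(ℝ, E)) x).baseSet := by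
    simp [chartAt_source]
  rw [← Bundle.Trivialization.symmL_apply (R := ℝ) _ hz,
    TangentBundle.symmL_trivializationAt_eq_core (by simp [chartAt_source]),
    tangentCoordChange_eq_one]
  rfl

/-- **`FiberBundle.extend` is the constant extension.** In the chart `U`, the local extension of a
tangent vector `v ∈ T_x U = E` used by the prelude's Koszul formula and Hessian is the constant
vector field `y ↦ v` (O'Neill 1983, Ch. 3, proof of Prop. 13: "let the extensions have constant
components"). [folklore] -/
theorem extend_eq_const (x : U) (v : TangentSpace 𝓘(ℝ, E) x) :
    FiberBundle.extend E v = fun _ : U ↦ (v : E) := by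
  funext z
  simp only [FiberBundle.extend]
  rw [show ((trivializationAt E (TangentSpace 𝓘(ℝ, E)) x) ⟨x, v⟩).2 = v from by
    rw [trivializationAt_apply]]
  exact trivializationAt_symm_apply x z v

/-- A vector field on `U` is `C^n` as a section of `TU` iff it is `C^n` as a map `U → E`.
[folklore] -/
theorem contMDiffAt_section_iff (x : U) {n : WithTop ℕ∞}
    (V : Π y : U, TangentSpace 𝓘(ℝ, E) y) :
    CMDiffAt n (T% V) x ↔ ContMDiffAt 𝓘(ℝ, E) 𝓘(ℝ, E) n (fun y : U ↦ (V y : E)) x := by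
  rw [Bundle.contMDiffAt_section]
  simp_rw [trivializationAt_apply]

/-- A vector field on `U` is differentiable as a section of `TU` iff it is differentiable as a
map `U → E`. [folklore] -/
theorem mdifferentiableAt_section_iff (x : U) (V : Π y : U, TangentSpace 𝓘(ℝ, E) y) :
    MDiffAt (T% V) x ↔ MDifferentiableAt 𝓘(ℝ, E) 𝓘(ℝ, E) (fun y : U ↦ (V y : E)) x := by
  rw [mdifferentiableAt_section]
  simp_rw [trivializationAt_apply]

/-- Constant vector fields on `U` are differentiable sections of `TU`. [folklore] -/
theorem mdifferentiableAt_const_section (x : U) (v : E) :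
    MDifferentiableAt 𝓘(ℝ, E) (𝓘(ℝ, E).prod 𝓘(ℝ, E))
      (fun y : U ↦ (Bundle.TotalSpace.mk' E y (v : TangentSpace 𝓘(ℝ, E) y) :
        TangentBundle 𝓘(ℝ, E) U)) x := by
  rw [mdifferentiableAt_section_iff]
  exact mdifferentiableAt_const

/-! ### Bundles of linear and bilinear forms over `U` are trivialised by the identity -/

/-- The continuous-linear inverse trivialisation of `TU` is the identity on fibres. [folklore] -/
theorem symmL_trivializationAt_apply (x z : U) (v : E) :
    (trivializationAt E (TangentSpace 𝓘(ℝ, E)) x).symmL ℝ z v = v := by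
  rw [Bundle.Trivialization.symmL_apply _ (by simp [chartAt_source])]
  exact trivializationAt_symm_apply x z v

/-- The continuous-linear trivialisation of `TU` is the identity on fibres. [folklore] -/
theorem continuousLinearMapAt_trivializationAt_apply (x z : U) (v : TangentSpace 𝓘(ℝ, E) z) :
    (trivializationAt E (TangentSpace 𝓘(ℝ, E)) x).continuousLinearMapAt ℝ z v = v := by
  have h := Bundle.Trivialization.continuousLinearMapAt_apply_of_mem (R := ℝ)
    (trivializationAt E (TangentSpace 𝓘(ℝ, E)) x) (b := z) (by simp [chartAt_source]) v
  exact h.trans (congrArg Prod.snd (trivializationAt_apply x z v))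

/-- The preferred trivialisation of the bundle of covectors `y ↦ (T_y U →L[ℝ] ℝ)` (Mathlib's
hom-bundle to the trivial line bundle) is the identity on fibres. [folklore] -/
theorem dual_trivializationAt_continuousLinearMapAt_apply (x z : U)
    (φ : TangentSpace 𝓘(ℝ, E) z →L[ℝ] ℝ) (u : E) :
    (trivializationAt (E →L[ℝ] ℝ) (fun y : U ↦ TangentSpace 𝓘(ℝ, E) y →L[ℝ] ℝ) x).continuousLinearMapAt
      ℝ z φ u = φ u := by
  have h := Bundle.Trivialization.continuousLinearMapAt_apply_of_mem (R := ℝ)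
    (trivializationAt (E →L[ℝ] ℝ) (fun y : U ↦ TangentSpace 𝓘(ℝ, E) y →L[ℝ] ℝ) x) (b := z)
    (by simp [chartAt_source]) φ
  rw [hom_trivializationAt_apply] at h
  have h2 : ContinuousLinearMap.inCoordinates E (TangentSpace 𝓘(ℝ, E)) ℝ (Bundle.Trivial U ℝ)
      x z x z φ u = φ u := by
    simp only [ContinuousLinearMap.inCoordinates, ContinuousLinearMap.coe_comp,
      Function.comp_apply, Bundle.Trivial.fiberBundle_trivializationAt',
      Bundle.Trivial.continuousLinearMapAt_trivialization, ContinuousLinearMap.coe_id', id_eq]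
    rw [symmL_trivializationAt_apply]
  exact (DFunLike.congr_fun h u).trans h2

/-- The preferred trivialisation of the bundle of bilinear forms `y ↦ (T_y U →L T_y U →L ℝ)`, in
which the prelude's metrics are sections (`PseudoRiemannianMetric.contMDiff`), is the identity on
fibres. [folklore] -/
theorem bilin_trivializationAt_apply (x z : U)
    (B : TangentSpace 𝓘(ℝ, E) z →L[ℝ] TangentSpace 𝓘(ℝ, E) z →L[ℝ] ℝ) (v w : E) :
    (trivializationAt (E →L[ℝ] E →L[ℝ] ℝ)
      (fun y : U ↦ TangentSpace 𝓘(ℝ, E) y →L[ℝ] TangentSpace 𝓘(ℝ, E) y →L[ℝ] ℝ) x ⟨z, B⟩).2 v w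
      = B v w := by
  rw [hom_trivializationAt_apply]
  simp only [ContinuousLinearMap.inCoordinates, ContinuousLinearMap.coe_comp,
    Function.comp_apply]
  rw [symmL_trivializationAt_apply, dual_trivializationAt_continuousLinearMapAt_apply]

/-- **A field of bilinear forms on `U` is `C^n` as a bundle section iff its representative
`G : E → (E →L E →L ℝ)` is `C^n`.** This turns the regularity field of a
`PseudoRiemannianMetric` on `U` (a statement about sections of `Hom(TU, Hom(TU, ℝ))`) into
ordinary calculus. [folklore] -/
theorem contMDiffAt_bilinSection_iff (x : U) {n : WithTop ℕ∞}
    (B : Π y : U, TangentSpace 𝓘(ℝ, E) y →L[ℝ] TangentSpace 𝓘(ℝ, E) y →L[ℝ] ℝ)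
    (G : E → E →L[ℝ] E →L[ℝ] ℝ) (h : ∀ y : U, B y = G y) :
    ContMDiffAt 𝓘(ℝ, E) (𝓘(ℝ, E).prod 𝓘(ℝ, E →L[ℝ] E →L[ℝ] ℝ)) n
      (fun y : U ↦ Bundle.TotalSpace.mk' (E →L[ℝ] E →L[ℝ] ℝ)
        (E := fun y : U ↦ TangentSpace 𝓘(ℝ, E) y →L[ℝ] TangentSpace 𝓘(ℝ, E) y →L[ℝ] ℝ) y (B y)) x ↔
      ContDiffAt ℝ n G x := by
  rw [Bundle.contMDiffAt_section]
  have key : (fun y : U ↦ (trivializationAt (E →L[ℝ] E →L[ℝ] ℝ)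
      (fun y : U ↦ TangentSpace 𝓘(ℝ, E) y →L[ℝ] TangentSpace 𝓘(ℝ, E) y →L[ℝ] ℝ) x
        ⟨y, B y⟩).2) = fun y : U ↦ G y := by
    funext y
    ext v w
    rw [bilin_trivializationAt_apply, h]
    rfl
  rw [key]
  exact contMDiffAt_iff x _ G (fun _ ↦ rfl)

/-! ### The Lie bracket in `U` -/

/-- In the chart at `x`, the pull-back of a vector field `V` of `U` with `V y = Φ y` agrees with
`Φ` near `x`. [folklore] -/
theorem mpullbackWithin_symm_eventuallyEq (x : U) (V : Π y : U, TangentSpace 𝓘(ℝ, E) y)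
    (Φ : E → E) (h : ∀ y : U, V y = Φ y) :
    mpullbackWithin 𝓘(ℝ, E) 𝓘(ℝ, E) (extChartAt 𝓘(ℝ, E) x).symm V (range 𝓘(ℝ, E))
      =ᶠ[𝓝 (x : E)] Φ := by
  filter_upwards [coe_mem_nhds x] with y hy
  rw [mpullbackWithin_apply, ModelWithCorners.range_eq_univ, mfderivWithin_univ,
    inverse_mfderiv_extChartAt_symm_apply x hy, h, extChartAt_symm_val x hy]

/-- **The manifold Lie bracket in `U` is the Lie bracket of representatives**:
`mlieBracket V W x = [Φ, Ψ](x) = DΨ(x)(Φ x) − DΦ(x)(Ψ x)` for `V y = Φ y`, `W y = Ψ y`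
(Mathlib's `mlieBracketWithin_eq_lieBracketWithin` is the case `U = E`). [folklore] -/
theorem mlieBracket_eq (x : U) (V W : Π y : U, TangentSpace 𝓘(ℝ, E) y) (Φ Ψ : E → E)
    (hV : ∀ y : U, V y = Φ y) (hW : ∀ y : U, W y = Ψ y) :
    mlieBracket 𝓘(ℝ, E) V W x = lieBracket ℝ Φ Ψ (x : E) := by
  rw [← mlieBracketWithin_univ, mlieBracketWithin_apply, inverse_mfderiv_extChartAt_apply,
    Set.preimage_univ, Set.univ_inter, ModelWithCorners.range_eq_univ, lieBracketWithin_univ,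
    extChartAt_apply]
  have h1 := mpullbackWithin_symm_eventuallyEq x V Φ hV
  have h2 := mpullbackWithin_symm_eventuallyEq x W Ψ hW
  rw [ModelWithCorners.range_eq_univ] at h1 h2
  rw [← lieBracketWithin_univ, ← lieBracketWithin_univ]
  exact h1.lieBracketWithin_vectorField_eq_nhds h2

/-- **Constant vector fields of a chart commute**: `[X₀, Y₀] = 0` (O'Neill 1983, Ch. 3, proof
of Prop. 13: "the brackets are zero"). [folklore] -/
theorem mlieBracket_const (x : U) (v w : E) :
    mlieBracket 𝓘(ℝ, E) (fun _ : U ↦ (v : E) : Π y : U, TangentSpace 𝓘(ℝ, E) y)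
      (fun _ : U ↦ (w : E) : Π y : U, TangentSpace 𝓘(ℝ, E) y) x = 0 := by
  rw [mlieBracket_eq x _ _ (fun _ ↦ v) (fun _ ↦ w) (fun _ ↦ rfl) (fun _ ↦ rfl)]
  simp only [lieBracket_eq, fderiv_fun_const, Pi.zero_apply, zero_apply,
    sub_self]
  rfl

end OpensChart

/-! ## Uniqueness clauses of the prelude's Levi-Civita function and Hessian (any manifold) -/

namespace PseudoRiemannianMetric

open FiberBundle

variable {E : Type*} [NormedAddCommGroup E] [NormedSpace ℝ E] {H : Type*} [TopologicalSpace H]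
  {I : ModelWithCorners ℝ E H} {M : Type*} [TopologicalSpace M] [ChartedSpace H M]
  [IsManifold I ∞ M] {n : ℕ∞ω} {x : M}
  (g : PseudoRiemannianMetric I n E (TangentSpace I : M → Type _))
  [FiniteDimensional ℝ E] [CompleteSpace E] [Fact (1 ≤ n)]

omit [FiniteDimensional ℝ E] [CompleteSpace E] [Fact (1 ≤ n)] in
/-- **Uniqueness in the definition of `leviCivitaFun`.** If a continuous linear map `A` on `T_x M`
satisfies the Koszul identity `2 g_x(A X₀, Z₀) = K(X̃₀, Y, Z̃₀)(x)` on extended vectors, then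
`leviCivitaFun g Y x = A` (the `dite` in the definition picks *some* such map, and any two agree by
nondegeneracy of `g_x`). O'Neill 1983, Ch. 3, proof of Thm. 11 ("`D_V W` is uniquely determined").
[cite: ONeill1983, Ch. 3, Thm. 3.11] -/
theorem leviCivitaFun_eq_of_forall {Y : Π x : M, TangentSpace I x}
    (A : TangentSpace I x →L[ℝ] TangentSpace I x)
    (hA : ∀ X₀ Z₀ : TangentSpace I x,
      2 * g.val x (A X₀) Z₀ = g.koszulFunctional (extend E X₀) Y (extend E Z₀) x) :
    g.leviCivitaFun Y x = A := by
  have h : ∃ A : TangentSpace I x →L[ℝ] TangentSpace I x, ∀ X₀ Z₀ : TangentSpace I x,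
      2 * g.val x (A X₀) Z₀ = g.koszulFunctional (extend E X₀) Y (extend E Z₀) x := ⟨A, hA⟩
  have hspec := h.choose_spec
  simp only [leviCivitaFun, dif_pos h]
  ext X₀
  have hsub : h.choose X₀ - A X₀ = 0 := by
    refine g.nondegenerate x _ fun Z₀ ↦ ?_
    have h1 := hspec X₀ Z₀
    have h2 := hA X₀ Z₀
    rw [map_sub, sub_apply]
    linarith
  exact sub_eq_zero.mp hsub

variable [g.HasLeviCivita]

omit [FiniteDimensional ℝ E] [CompleteSpace E] [Fact (1 ≤ n)] in
/-- Uniqueness for the bundled Levi-Civita connection: a continuous linear map satisfying the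
Koszul identity on extended vectors *is* `(∇Y)_x`. O'Neill 1983, Ch. 3, Thm. 11.
[cite: ONeill1983, Ch. 3, Thm. 3.11] -/
theorem leviCivita_eq_of_forall {Y : Π x : M, TangentSpace I x}
    (A : TangentSpace I x →L[ℝ] TangentSpace I x)
    (hA : ∀ X₀ Z₀ : TangentSpace I x,
      2 * g.val x (A X₀) Z₀ = g.koszulFunctional (extend E X₀) Y (extend E Z₀) x) :
    g.leviCivita Y x = A := by
  rw [leviCivita_apply]
  exact g.leviCivitaFun_eq_of_forall A hA

omit [FiniteDimensional ℝ E] [CompleteSpace E] [Fact (1 ≤ n)] in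
/-- **Uniqueness in the definition of `hessian`.** A bilinear form agreeing with `hessianAux g f`
on extended vectors *is* `Hess f (x)` (two bilinear forms with the same values are equal).
O'Neill 1983, Ch. 3, Def. 48–Lemma 49. [cite: ONeill1983, Ch. 3, Lemma 3.49] -/
theorem hessian_eq_of_forall {f : M → ℝ} (B : LinearMap.BilinForm ℝ (TangentSpace I x))
    (hB : ∀ X₀ Y₀ : TangentSpace I x, B X₀ Y₀ = g.hessianAux f (extend E X₀) (extend E Y₀) x) :
    g.hessian f x = B := by
  have h : ∃ B : LinearMap.BilinForm ℝ (TangentSpace I x), ∀ X₀ Y₀ : TangentSpace I x,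
      B X₀ Y₀ = g.hessianAux f (extend E X₀) (extend E Y₀) x := ⟨B, hB⟩
  simp only [hessian, dif_pos h]
  refine LinearMap.ext₂ fun X₀ Y₀ ↦ ?_
  rw [h.choose_spec X₀ Y₀, hB X₀ Y₀]


/-! ### Uniqueness of the musical isomorphism (any bundle metric) -/

section Sharp

variable {EB : Type*} [NormedAddCommGroup EB] [NormedSpace ℝ EB] {HB : Type*}
  [TopologicalSpace HB] {IB : ModelWithCorners ℝ EB HB} {n' : WithTop ℕ∞}
  {B : Type*} [TopologicalSpace B] [ChartedSpace HB B]
  {F' : Type*} [NormedAddCommGroup F'] [NormedSpace ℝ F']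
  {V : B → Type*} [TopologicalSpace (Bundle.TotalSpace F' V)]
  [∀ b, TopologicalSpace (V b)] [∀ b, AddCommGroup (V b)] [∀ b, Module ℝ (V b)]
  [FiberBundle F' V] [VectorBundle ℝ F' V] [FiniteDimensional ℝ F']

/-- **Uniqueness of `♯`**: if `g_b(v, w) = α(w)` for all `w` then `♯α = v` (nondegeneracy).
O'Neill 1983, Ch. 3, Prop. 10 (a)–(b), p. 60: metrically equivalent vectors and covectors
("if `⟨V, X⟩ = ⟨W, X⟩` for all `X` then `V = W`", by nondegeneracy).
[cite: ONeill1983, Ch. 3, Prop. 3.10] -/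
theorem sharp_eq_of_forall (g' : PseudoRiemannianMetric IB n' F' V) (b : B)
    (α : Module.Dual ℝ (V b)) (v : V b) (h : ∀ w, g'.val b v w = α w) : g'.sharp b α = v := by
  have hsub : g'.sharp b α - v = 0 := by
    refine g'.nondegenerate b _ fun w ↦ ?_
    rw [map_sub, sub_apply, g'.val_sharp_apply, h w, sub_self]
  exact sub_eq_zero.mp hsub

end Sharp

end PseudoRiemannianMetric

/-! ## The Levi-Civita connection, Hessian and wave operator in the chart `U` -/

namespace OpensChart

variable {E : Type*} [NormedAddCommGroup E] [NormedSpace ℝ E] [FiniteDimensional ℝ E]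
  [CompleteSpace E] {U : Opens E} {n : ℕ∞ω} [Fact (1 ≤ n)]
  (g : PseudoRiemannianMetric 𝓘(ℝ, E) n E (TangentSpace 𝓘(ℝ, E) : U → Type _))
  (G : E → E →L[ℝ] E →L[ℝ] ℝ)

omit [FiniteDimensional ℝ E] [CompleteSpace E] in
/-- Derivative of a metric component: `∂_v (G(·)(Y₀, Z₀))(x) = DG(x)(v)(Y₀, Z₀)` (evaluation is
linear). [folklore] -/
theorem fderiv_apply₂ {x : E} (hG : DifferentiableAt ℝ G x) (Y₀ Z₀ v : E) :
    fderiv ℝ (fun y ↦ G y Y₀ Z₀) x v = fderiv ℝ G x v Y₀ Z₀ := by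
  have h1 : DifferentiableAt ℝ (fun y ↦ G y Y₀) x := hG.clm_apply (differentiableAt_const Y₀)
  have e1 : fderiv ℝ (fun y ↦ G y Y₀ Z₀) x =
      (G x Y₀).comp (fderiv ℝ (fun _ : E ↦ Z₀) x) + (fderiv ℝ (fun y ↦ G y Y₀) x).flip Z₀ :=
    fderiv_clm_apply h1 (differentiableAt_const Z₀)
  have e2 : fderiv ℝ (fun y ↦ G y Y₀) x =
      (G x).comp (fderiv ℝ (fun _ : E ↦ Y₀) x) + (fderiv ℝ G x).flip Y₀ :=
    fderiv_clm_apply hG (differentiableAt_const Y₀)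
  rw [e1, e2, fderiv_fun_const, fderiv_fun_const]
  simp only [Pi.zero_apply, ContinuousLinearMap.comp_zero, add_apply,
    zero_apply, ContinuousLinearMap.flip_apply, zero_add]

omit [FiniteDimensional ℝ E] [CompleteSpace E] in
/-- The metric components `y ↦ G y Y₀ Z₀` are differentiable where `G` is. [folklore] -/
theorem differentiableAt_apply₂ {x : E} (hG : DifferentiableAt ℝ G x) (Y₀ Z₀ : E) :
    DifferentiableAt ℝ (fun y ↦ G y Y₀ Z₀) x :=
  (hG.clm_apply (differentiableAt_const Y₀)).clm_apply (differentiableAt_const Z₀)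

/-- The **Koszul form** of the metric components `G` at `x` with middle slot `Y₀`: the bilinear
form `(X₀, Z₀) ↦ ∂_{X₀}G(Y₀, Z₀) + ∂_{Y₀}G(Z₀, X₀) − ∂_{Z₀}G(X₀, Y₀)`, i.e. twice the Christoffel
symbol of the first kind `2 Γ_{Z₀ X₀ Y₀} = 2 g(D_{X₀} Y₀, Z₀)` (O'Neill 1983, Ch. 3, proof of
Prop. 13: the Koszul formula with vanishing brackets). [cite: ONeill1983, Ch. 3, Prop. 3.13] -/
def koszulForm (x Y₀ : E) : E →ₗ[ℝ] E →ₗ[ℝ] ℝ :=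
  LinearMap.mk₂ ℝ
    (fun X₀ Z₀ ↦ fderiv ℝ G x X₀ Y₀ Z₀ + fderiv ℝ G x Y₀ Z₀ X₀ - fderiv ℝ G x Z₀ X₀ Y₀)
    (fun X₁ X₂ Z₀ ↦ by simp only [map_add, add_apply]; ring)
    (fun c X₀ Z₀ ↦ by simp only [map_smul, smul_apply, smul_eq_mul]; ring)
    (fun X₀ Z₁ Z₂ ↦ by simp only [map_add, add_apply]; ring)
    (fun c X₀ Z₀ ↦ by simp only [map_smul, smul_apply, smul_eq_mul]; ring)

omit [FiniteDimensional ℝ E] [CompleteSpace E] in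
/-- Unfolding lemma for the Koszul form. [cite: ONeill1983, Ch. 3, Prop. 3.13] -/
@[simp]
theorem koszulForm_apply (x Y₀ X₀ Z₀ : E) :
    koszulForm G x Y₀ X₀ Z₀ =
      fderiv ℝ G x X₀ Y₀ Z₀ + fderiv ℝ G x Y₀ Z₀ X₀ - fderiv ℝ G x Z₀ X₀ Y₀ := rfl

omit [FiniteDimensional ℝ E] [CompleteSpace E] in
/-- The Koszul form is additive in its middle slot. [folklore] -/
theorem koszulForm_add_mid (x Y₁ Y₂ : E) :
    koszulForm G x (Y₁ + Y₂) = koszulForm G x Y₁ + koszulForm G x Y₂ := by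
  refine LinearMap.ext₂ fun X₀ Z₀ ↦ ?_
  simp only [koszulForm_apply, map_add, LinearMap.add_apply, add_apply]
  ring

omit [FiniteDimensional ℝ E] [CompleteSpace E] in
/-- The Koszul form is homogeneous in its middle slot. [folklore] -/
theorem koszulForm_smul_mid (x : E) (c : ℝ) (Y₀ : E) :
    koszulForm G x (c • Y₀) = c • koszulForm G x Y₀ := by
  refine LinearMap.ext₂ fun X₀ Z₀ ↦ ?_
  simp only [koszulForm_apply, map_smul, LinearMap.smul_apply, smul_apply,
    smul_eq_mul]
  ring

variable {g G} (hG : ∀ y : U, g.val y = G y)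
include hG

omit [FiniteDimensional ℝ E] [CompleteSpace E] [Fact (1 ≤ n)] in
/-- **The Koszul functional on constant vector fields of a chart** is the Koszul form of the
components: `K(X₀, Y₀, Z₀)(x) = ∂_{X₀}G(Y₀, Z₀) + ∂_{Y₀}G(Z₀, X₀) − ∂_{Z₀}G(X₀, Y₀)` (all brackets
vanish). O'Neill 1983, Ch. 3, proof of Prop. 13. [cite: ONeill1983, Ch. 3, Prop. 3.13] -/
theorem koszulFunctional_const (x : U) (hGx : DifferentiableAt ℝ G x) (X₀ Y₀ Z₀ : E) :
    g.koszulFunctional (fun _ : U ↦ (X₀ : E)) (fun _ : U ↦ (Y₀ : E)) (fun _ : U ↦ (Z₀ : E)) x =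
      koszulForm G x Y₀ X₀ Z₀ := by
  simp only [PseudoRiemannianMetric.koszulFunctional, mlieBracket_const, map_zero, sub_zero,
    add_zero, koszulForm_apply]
  have h : ∀ A B : E, (fun y : U ↦ g.val y A B) = fun y : U ↦ G y A B := by
    intro A B; funext y; rw [hG]; rfl
  rw [h, h, h, mvfderiv_eq x _ (fun y ↦ G y Y₀ Z₀) (fun _ ↦ rfl) (differentiableAt_apply₂ G hGx _ _),
    mvfderiv_eq x _ (fun y ↦ G y Z₀ X₀) (fun _ ↦ rfl) (differentiableAt_apply₂ G hGx _ _),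
    mvfderiv_eq x _ (fun y ↦ G y X₀ Y₀) (fun _ ↦ rfl) (differentiableAt_apply₂ G hGx _ _),
    fderiv_apply₂ G hGx, fderiv_apply₂ G hGx, fderiv_apply₂ G hGx]

omit hG in
variable (g G) in
/-- The **Christoffel map** of the metric `g` with components `G` at `x ∈ U`: for `Y₀ ∈ E`, the
continuous linear map `X₀ ↦ Γ_x(X₀, Y₀) = ♯(½ K(X₀, Y₀, ·)) ∈ E`, i.e. `Γ(∂_i, ∂_j) = ∑_k Γ^k_{ij} ∂_k`
with `Γ^k_{ij} = ½ g^{km}(∂_i g_{jm} + ∂_j g_{im} − ∂_m g_{ij})` (O'Neill 1983, Ch. 3, Def. 12 and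
Prop. 13 (2)). Stated at the model type `E` (definitionally the tangent space).
[cite: ONeill1983, Ch. 3, Prop. 3.13] -/
def christoffel (x : U) (Y₀ : E) : E →L[ℝ] E :=
  LinearMap.toContinuousLinearMap
    (((g.sharp x).toLinearMap : Module.Dual ℝ E →ₗ[ℝ] E) ∘ₗ ((2 : ℝ)⁻¹ • koszulForm G (x : E) Y₀))

omit hG in
omit [CompleteSpace E] [Fact (1 ≤ n)] in
/-- Unfolding lemma: `Γ_x(X₀, Y₀) = ♯(½ K(X₀, Y₀, ·))`. [cite: ONeill1983, Ch. 3, Prop. 3.13] -/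
theorem christoffel_apply (x : U) (Y₀ X₀ : E) :
    christoffel g G x Y₀ X₀ = g.sharp x ((2 : ℝ)⁻¹ • koszulForm G (x : E) Y₀ X₀) := rfl

omit hG in
omit [CompleteSpace E] [Fact (1 ≤ n)] in
/-- **Defining property of the Christoffel map**: `2 g_x(Γ(X₀, Y₀), Z₀) = K(X₀, Y₀, Z₀)`
(O'Neill 1983, Ch. 3, proof of Prop. 13: `2⟨D_{∂_i} ∂_j, ∂_m⟩ = ∂_i g_{jm} + ∂_j g_{im} − ∂_m g_{ij}`).
[cite: ONeill1983, Ch. 3, Prop. 3.13] -/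
theorem two_mul_val_christoffel (x : U) (Y₀ X₀ Z₀ : E) :
    2 * g.val x (christoffel g G x Y₀ X₀) Z₀ = koszulForm G x Y₀ X₀ Z₀ := by
  show 2 * g.val x (g.sharp x (((2 : ℝ)⁻¹ • koszulForm G (x : E) Y₀) X₀)) Z₀ = _
  rw [g.val_sharp_apply]
  show 2 * (2⁻¹ * koszulForm G x Y₀ X₀ Z₀) = _
  ring

omit hG in
omit [CompleteSpace E] [Fact (1 ≤ n)] in
/-- The Christoffel map is additive in `Y₀`. [folklore] -/
theorem christoffel_add (x : U) (Y₁ Y₂ X₀ : E) :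
    christoffel g G x (Y₁ + Y₂) X₀ = christoffel g G x Y₁ X₀ + christoffel g G x Y₂ X₀ := by
  simp only [christoffel_apply, koszulForm_add_mid, LinearMap.add_apply, smul_add]
  exact map_add (g.sharp x) _ _

omit hG in
omit [CompleteSpace E] [Fact (1 ≤ n)] in
/-- The Christoffel map is homogeneous in `Y₀`. [folklore] -/
theorem christoffel_smul (x : U) (c : ℝ) (Y₀ X₀ : E) :
    christoffel g G x (c • Y₀) X₀ = c • christoffel g G x Y₀ X₀ := by
  simp only [christoffel_apply, koszulForm_smul_mid, LinearMap.smul_apply]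
  rw [smul_comm]
  exact map_smul (g.sharp x) c _

omit [CompleteSpace E] [Fact (1 ≤ n)] in
/-- **The Levi-Civita connection on constant fields of a chart is the Christoffel map**:
`(∇ Y₀)_x = Γ_x(·, Y₀)`, i.e. `D_{∂_i} ∂_j = ∑_k Γ^k_{ij} ∂_k` with `Γ^k_{ij}` given by the metric
(O'Neill 1983, Ch. 3, Def. 12 and Prop. 13 (2)), for a metric with components `g.val y = G y`
differentiable at `x`. [cite: ONeill1983, Ch. 3, Prop. 3.13] -/
theorem leviCivita_const [g.HasLeviCivita] (x : U) (hGx : DifferentiableAt ℝ G x) (Y₀ : E) :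
    g.leviCivita (fun _ : U ↦ (Y₀ : E)) x = christoffel g G x Y₀ := by
  refine g.leviCivita_eq_of_forall _ fun X₀ Z₀ ↦ ?_
  rw [extend_eq_const, extend_eq_const, koszulFunctional_const hG x hGx]
  exact two_mul_val_christoffel x Y₀ X₀ Z₀

omit [CompleteSpace E] [Fact (1 ≤ n)] in
/-- Pointwise form of `leviCivita_const`: `∇_{X₀} Y₀ (x) = Γ_x(X₀, Y₀)`.
[cite: ONeill1983, Ch. 3, Prop. 3.13] -/
theorem leviCivita_const_apply [g.HasLeviCivita] (x : U) (hGx : DifferentiableAt ℝ G x)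
    (Y₀ X₀ : E) :
    g.leviCivita (fun _ : U ↦ (Y₀ : E)) x X₀ = christoffel g G x Y₀ X₀ := by
  rw [leviCivita_const hG x hGx]
  rfl

/-! ### The Hessian and the wave operator -/

omit hG in
variable (g G) in
/-- The **coordinate Hessian form** of `Φ : E → ℝ` at `x ∈ U` for the metric components `G`:
`(X₀, Y₀) ↦ D²Φ(x)(X₀, Y₀) − DΦ(x)(Γ_x(X₀, Y₀))`, i.e. `H_{ij} = ∂_i∂_j Φ − Γ^k_{ij} ∂_k Φ`
(O'Neill 1983, Ch. 3, Lemma 49 and the display after Def. 50). [cite: ONeill1983, Ch. 3, Lemma 3.49] -/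
def hessianForm (Φ : E → ℝ) (x : U) : LinearMap.BilinForm ℝ E :=
  LinearMap.mk₂ ℝ
    (fun X₀ Y₀ ↦ fderiv ℝ (fderiv ℝ Φ) x X₀ Y₀ - fderiv ℝ Φ x (christoffel g G x Y₀ X₀))
    (fun X₁ X₂ Y₀ ↦ by simp only [map_add, add_apply]; ring)
    (fun c X₀ Y₀ ↦ by simp only [map_smul, smul_apply, smul_eq_mul]; ring)
    (fun X₀ Y₁ Y₂ ↦ by simp only [map_add, christoffel_add]; ring)
    (fun c X₀ Y₀ ↦ by simp only [map_smul, christoffel_smul, smul_eq_mul]; ring)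

omit hG in
omit [CompleteSpace E] [Fact (1 ≤ n)] in
/-- Unfolding lemma for the coordinate Hessian form. [cite: ONeill1983, Ch. 3, Lemma 3.49] -/
@[simp]
theorem hessianForm_apply (Φ : E → ℝ) (x : U) (X₀ Y₀ : E) :
    hessianForm g G Φ x X₀ Y₀ =
      fderiv ℝ (fderiv ℝ Φ) x X₀ Y₀ - fderiv ℝ Φ x (christoffel g G x Y₀ X₀) := rfl

omit [CompleteSpace E] [Fact (1 ≤ n)] in
/-- The prelude's `hessianAux` on constant fields of the chart: for `f y = Φ y` with `Φ` of class
`C²` at `x`, `X₀(Y₀ f)(x) − (∇_{X₀} Y₀) f (x) = D²Φ(x)(X₀, Y₀) − DΦ(x)(Γ_x(X₀, Y₀))`.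
O'Neill 1983, Ch. 3, Lemma 49. [cite: ONeill1983, Ch. 3, Lemma 3.49] -/
theorem hessianAux_const [g.HasLeviCivita] (x : U) (hGx : DifferentiableAt ℝ G x) {f : U → ℝ}
    {Φ : E → ℝ} (hf : ∀ y : U, f y = Φ y) (hΦ : ContDiffAt ℝ 2 Φ x) (X₀ Y₀ : E) :
    g.hessianAux f (fun _ : U ↦ (X₀ : E)) (fun _ : U ↦ (Y₀ : E)) x = hessianForm g G Φ x X₀ Y₀ := by
  simp only [PseudoRiemannianMetric.hessianAux, hessianForm_apply]
  have hΦ1 : DifferentiableAt ℝ Φ x := hΦ.differentiableAt (by norm_num)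
  have hΦ2 : DifferentiableAt ℝ (fderiv ℝ Φ) x :=
    (hΦ.fderiv_right (m := 1) le_rfl).differentiableAt one_ne_zero
  have hev : ∀ᶠ y in 𝓝 x, DifferentiableAt ℝ Φ ((y : U) : E) := by
    have h1 : ∀ᶠ z in 𝓝 (x : E), ContDiffAt ℝ 2 Φ z := hΦ.eventually (by simp)
    have h2 := continuous_subtype_val.continuousAt.eventually h1
    filter_upwards [h2] with y hy
    exact hy.differentiableAt (by norm_num)
  have hinner : (fun y : U ↦ mvfderiv 𝓘(ℝ, E) f y Y₀) =ᶠ[𝓝 x]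
      fun y : U ↦ fderiv ℝ Φ y Y₀ := by
    filter_upwards [hev] with y hy
    exact mvfderiv_eq y f Φ hf hy Y₀
  have houter : mvfderiv 𝓘(ℝ, E) (fun y : U ↦ mvfderiv 𝓘(ℝ, E) f y Y₀) x X₀ =
      mvfderiv 𝓘(ℝ, E) (fun y : U ↦ fderiv ℝ Φ y Y₀) x X₀ := by
    have key := hinner.mfderiv_eq (I := 𝓘(ℝ, E)) (I' := 𝓘(ℝ, ℝ))
    show mfderiv 𝓘(ℝ, E) 𝓘(ℝ, ℝ) (fun y : U ↦ mvfderiv 𝓘(ℝ, E) f y Y₀) x X₀ =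
      mfderiv 𝓘(ℝ, E) 𝓘(ℝ, ℝ) (fun y : U ↦ fderiv ℝ Φ y Y₀) x X₀
    rw [key]
    rfl
  rw [houter, mvfderiv_eq x _ (fun z : E ↦ fderiv ℝ Φ z Y₀) (fun _ ↦ rfl)
    (hΦ2.clm_apply (differentiableAt_const Y₀)), fderiv_clm_apply hΦ2 (differentiableAt_const Y₀),
    leviCivita_const_apply hG x hGx, mvfderiv_eq x f Φ hf hΦ1]
  simp only [fderiv_fun_const, Pi.zero_apply, ContinuousLinearMap.comp_zero,
    ContinuousLinearMap.flip_apply, zero_add]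

omit [CompleteSpace E] [Fact (1 ≤ n)] in
/-- **The Hessian in a chart.** For a metric on `U` with differentiable components `G` at `x`
and `f : U → ℝ` with a representative `Φ` of class `C²` at `x`, the prelude's `g.hessian f x` is
the coordinate Hessian form: `Hess f (X₀, Y₀) = D²Φ(x)(X₀, Y₀) − DΦ(x)(Γ_x(X₀, Y₀))`, i.e.
`H_{ij} = ∂_i∂_j Φ − Γ^k_{ij} ∂_k Φ`. In particular the representing bilinear form in the prelude's
definition exists. O'Neill 1983, Ch. 3, Lemma 49. [cite: ONeill1983, Ch. 3, Lemma 3.49] -/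
theorem hessian_eq [g.HasLeviCivita] (x : U) (hGx : DifferentiableAt ℝ G x) {f : U → ℝ}
    {Φ : E → ℝ} (hf : ∀ y : U, f y = Φ y) (hΦ : ContDiffAt ℝ 2 Φ x) :
    g.hessian f x = hessianForm g G Φ x := by
  refine g.hessian_eq_of_forall _ fun X₀ Y₀ ↦ ?_
  rw [extend_eq_const, extend_eq_const, hessianAux_const hG x hGx hf hΦ]
  rfl

omit [CompleteSpace E] [Fact (1 ≤ n)] in
/-- **The wave operator in a chart, as a metric trace**: `□_g f (x) = tr (♯ ∘ H)` with `H` the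
coordinate Hessian form (O'Neill 1983, Ch. 3, Def. 50: `Δf = C₁₂(H^f)`).
[cite: ONeill1983, Ch. 3, Def. 3.50 ff.] -/
theorem dalembertian_eq [g.HasLeviCivita] (x : U) (hGx : DifferentiableAt ℝ G x) {f : U → ℝ}
    {Φ : E → ℝ} (hf : ∀ y : U, f y = Φ y) (hΦ : ContDiffAt ℝ 2 Φ x) :
    g.dalembertian f x =
      LinearMap.trace ℝ E (((g.sharp x).toLinearMap : Module.Dual ℝ E →ₗ[ℝ] E) ∘ₗ
        hessianForm g G Φ x) := by
  rw [PseudoRiemannianMetric.dalembertian, hessian_eq hG x hGx hf hΦ]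
  rfl

omit hG in
omit [FiniteDimensional ℝ E] [CompleteSpace E] [Fact (1 ≤ n)] in
/-- Linear algebra: the trace of `S ∘ B` (`B` a bilinear form read as `E → E*`, `S : E* → E`) in
a basis `b` is `∑_{ij} bⁱ(S bʲ) B(b_i, b_j)` (`bⁱ = b.coord i` the dual basis). With `S = ♯` this is
the metric contraction `g^{ij} B_{ij}` (O'Neill 1983, Ch. 3, pp. 60–61 and Lemma 3.36).
[folklore] -/
theorem trace_comp_bilinForm_eq_sum {ι : Type*} [Fintype ι] [DecidableEq ι]
    (b : Module.Basis ι ℝ E) (S : Module.Dual ℝ E →ₗ[ℝ] E) (B : LinearMap.BilinForm ℝ E) :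
    LinearMap.trace ℝ E (S ∘ₗ B) = ∑ i, ∑ j, b.coord i (S (b.coord j)) * B (b i) (b j) := by
  rw [LinearMap.trace_eq_matrix_trace ℝ b, Matrix.trace]
  refine Finset.sum_congr rfl fun i _ ↦ ?_
  rw [Matrix.diag_apply, LinearMap.toMatrix_apply, LinearMap.comp_apply]
  conv_lhs => rw [← b.sum_dual_apply_smul_coord (B (b i))]
  rw [map_sum, map_sum, Finsupp.finsetSum_apply]
  refine Finset.sum_congr rfl fun j _ ↦ ?_
  rw [map_smul, map_smul, Finsupp.smul_apply, smul_eq_mul, mul_comm]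
  rfl

omit [CompleteSpace E] [Fact (1 ≤ n)] in
/-- **The wave operator in a chart, coordinate formula**: in any basis `b` of `E` with dual
basis `bⁱ`, `□_g f (x) = ∑_{ij} g^{ij} (D²Φ(x)(b_i, b_j) − DΦ(x)(Γ_x(b_i, b_j)))` where
`g^{ij} = bⁱ(♯ bʲ)` is the inverse metric, i.e.
`□f = ∑ g^{ij}(∂_i∂_j f − Γ^k_{ij} ∂_k f)` (O'Neill 1983, Ch. 3, the display following Def. 50).
[cite: ONeill1983, Ch. 3, Def. 3.50 ff.] -/
theorem dalembertian_eq_sum [g.HasLeviCivita] {ι : Type*} [Fintype ι] [DecidableEq ι]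
    (b : Module.Basis ι ℝ E) (x : U) (hGx : DifferentiableAt ℝ G x) {f : U → ℝ} {Φ : E → ℝ}
    (hf : ∀ y : U, f y = Φ y) (hΦ : ContDiffAt ℝ 2 Φ x) :
    g.dalembertian f x =
      ∑ i, ∑ j, b.coord i (((g.sharp x).toLinearMap : Module.Dual ℝ E →ₗ[ℝ] E) (b.coord j)) *
        (fderiv ℝ (fderiv ℝ Φ) x (b i) (b j) - fderiv ℝ Φ x (christoffel g G x (b j) (b i))) := by
  rw [dalembertian_eq hG x hGx hf hΦ]
  exact trace_comp_bilinForm_eq_sum b _ _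

end OpensChart

end Literature.Geometry.Lorentzian

end
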